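import Literature.Combinatorics.Additive.Kneser
import Summits.MatrixMultiplication.OmegaCensus.STPPDisjointPacking

/-!
# ω-census (abelian STPP census, seat stpp-2), filter N8: the Kneser necessary condition (kernel)

HONEST FRAMING (pub-omega census; verbatim): lottery ticket; floor = certified bounds/negative ranges.
Census BOOKKEEPING (pub-omega stpp-2 gen 20, 2026-08-27).  A necessary condition ("filter N8") for the finite STPP census of
abelian groups, in the kernel, on top of the tree's Kneser theorem (`Literature.Combinatorics.Additive.add_kneser`).  Nothing here is
progress on `ω`.

For an STPP family `(Aᵢ, Bᵢ, Cᵢ)_{i<N}` (CKSU 2005 Def. 5.1, the tree's `IsSTPP`, additive abelian `H`) with non-empty sets put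
`Xᵢ = Bᵢ − Aᵢ`, `Yᵢ = Cᵢ − Bᵢ`, `Zᵢ = Cᵢ − Aᵢ` (as images of the difference maps).  Then (§2) `|Xᵢ| = |Aᵢ||Bᵢ|`, `|Yᵢ| = |Bᵢ||Cᵢ|`,
`|Zᵢ| = |Aᵢ||Cᵢ|`, each of the three families is pairwise disjoint, and Def. 5.1 (ii) says `x + y = z` with `x ∈ Xᵢ`, `y ∈ Y_k`,
`z ∈ Z_j` only if `i = j = k`; hence for every `j` (§3):
* (K1a) `(⋃ᵢ Xᵢ) + (⋃_{k ≠ j} Y_k) ⊆ H ∖ Z_j`,  (K1b) `(⋃_{i ≠ j} Xᵢ) + (⋃_k Y_k) ⊆ H ∖ Z_j`,  (K2) `X_j + Y_k ⊆ H ∖ ⋃ᵢ Zᵢ` (`j ≠ k`),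
and the same for the rotated families `(B, C, A)`, `(C, A, B)` (the tree's `stpp_rotate`, `STPPDisjointPacking.lean`).  By Kneser (§1: `exists_dvd_kneserLB_le_card_add`,
`|S + T| ≥ (⌈|S|/d⌉ + ⌈|T|/d⌉ − 1)·d` for SOME divisor `d` of `|H|`, namely `d = |Stab(S+T)|`), a pattern for which one of these
inclusions has `min_{d ∣ |H|} (⌈s/d⌉ + ⌈t/d⌉ − 1)·d > |target complement|` carries no STPP family: `not_isSTPP_of_n8Dead` (§4), with the
numeric side a DECIDABLE predicate `N8Dead n a b c` on the card vectors (mirror of the census engine v0.11 flag `STPP_N8`,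
`patterns.kneser_violation`).  §5 applies it to the cell's ℤ₅₆ frontier (kit j267433, census.py record `002addb58b8ac4c4`): of its 149
minimal undecided beating leaves 147 are `N8Dead 56` (re-derived ×3: stpp-2 / referee g204 / lead g30), e.g. `no_isSTPP_Z56_13b_234`
(`{(1,3,11),(2,3,4)}`); the per-leaf table (the other 146) is the sibling files `STPPKneserLeavesZ56{A,B,C}.lean` (names `no_isSTPP_Z56_<blocks>`, one base-36 digit per set
size, `b` = 11).
-/

open Finset
open scoped Pointwise

namespace Summit.MatrixMultiplication.OmegaCensus.STPPKneser

open Literature.Computability.AlgebraicComplexity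

/-! ## §1 Kneser's bound in the divisor form used by the census -/

section Kneser

variable {G : Type*} [AddCommGroup G] [DecidableEq G] [Fintype G]

/-- The Kneser lower bound for one candidate period `d`: `(⌈s/d⌉ + ⌈t/d⌉ − 1)·d` (natural-number ceiling division). [folklore] -/
def kneserLB (s t d : ℕ) : ℕ := ((s + d - 1) / d + (t + d - 1) / d - 1) * d

/-- A multiple of `d > 0` that is `≥ s` is `≥ ⌈s/d⌉·d`. [folklore] -/
theorem ceilDiv_mul_le_of_dvd {s d m : ℕ} (hd : 0 < d) (hdm : d ∣ m) (hsm : s ≤ m) : (s + d - 1) / d * d ≤ m := by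
  obtain ⟨q, rfl⟩ := hdm
  have h1 : (s + d - 1) / d ≤ q := by
    rw [Nat.div_le_iff_le_mul_add_pred hd]
    have : s ≤ d * q := hsm
    omega
  calc (s + d - 1) / d * d ≤ q * d := Nat.mul_le_mul_right d h1
    _ = d * q := Nat.mul_comm q d

/-- **Kneser's theorem in the census form.** For non-empty finite `S, T` in a finite abelian group there is a divisor `d` of `|G|`
(namely `d = |Stab(S + T)|`) with `(⌈|S|/d⌉ + ⌈|T|/d⌉ − 1)·d ≤ |S + T|`.
[cite: Kneser1953] [cite: TaoVu2006, Thm 5.5] -/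
theorem exists_dvd_kneserLB_le_card_add (S T : Finset G) (hS : S.Nonempty) (hT : T.Nonempty) :
    ∃ d : ℕ, 0 < d ∧ d ∣ Fintype.card G ∧ kneserLB (#S) (#T) d ≤ #(S + T) := by
  have hkn := Literature.Combinatorics.Additive.add_kneser S T
  set K := (S + T).addStab with hK
  have hKne : K.Nonempty := (hS.add hT).addStab
  refine ⟨#K, hKne.card_pos, (hS.add hT).card_addStab_dvd_card_univ, ?_⟩
  have h1 : (#S + #K - 1) / #K * #K ≤ #(S + K) :=
    ceilDiv_mul_le_of_dvd hKne.card_pos (Finset.card_addStab_dvd_card_add_addStab S (S + T)) (card_le_card_add_right hKne)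
  have h2 : (#T + #K - 1) / #K * #K ≤ #(T + K) :=
    ceilDiv_mul_le_of_dvd hKne.card_pos (Finset.card_addStab_dvd_card_add_addStab T (S + T)) (card_le_card_add_right hKne)
  unfold kneserLB
  have : ((#S + #K - 1) / #K + (#T + #K - 1) / #K - 1) * #K =
      (#S + #K - 1) / #K * #K + (#T + #K - 1) / #K * #K - #K := by
    rw [Nat.sub_mul, Nat.add_mul, one_mul]
  rw [this]
  omega

/-- Numeric corollary: if `S + T ⊆ U` and EVERY divisor `d` of `|G|` has `kneserLB |S| |T| d > |U|`, contradiction.  The divisor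
quantifier is over `Nat.divisors |G|` (decidable for a numeral). [cite: Kneser1953] -/
theorem false_of_kneserLB_gt (S T U : Finset G) (hS : S.Nonempty) (hT : T.Nonempty) (hsub : S + T ⊆ U)
    (h : ∀ d ∈ Nat.divisors (Fintype.card G), #U < kneserLB (#S) (#T) d) : False := by
  obtain ⟨d, hd, hdvd, hle⟩ := exists_dvd_kneserLB_le_card_add S T hS hT
  have hmem : d ∈ Nat.divisors (Fintype.card G) := Nat.mem_divisors.2 ⟨hdvd, Fintype.card_ne_zero⟩
  have := h d hmem
  have := card_le_card hsub
  omega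

end Kneser


/-! ## §2 The three difference families of an STPP family -/

section Families

variable {H : Type*} [AddCommGroup H] [DecidableEq H] {N : ℕ}

/-- The difference set `Fᵢ − Eᵢ` of block `i`, as the image of `(e, f) ↦ f − e` on `Eᵢ × Fᵢ`; with `(E, F) = (A, B), (B, C), (A, C)`
these are the census's `Xᵢ = Bᵢ − Aᵢ`, `Yᵢ = Cᵢ − Bᵢ`, `Zᵢ = Cᵢ − Aᵢ`. [folklore] -/
def D (E F : Fin N → Finset H) (i : Fin N) : Finset H := ((E i) ×ˢ (F i)).image fun p => p.2 - p.1

/-- Union of the difference sets over an index set. [folklore] -/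
def DU (E F : Fin N → Finset H) (I : Finset (Fin N)) : Finset H := I.biUnion (D E F)

omit [AddCommGroup H] in
/-- Membership in the image of the difference map (auxiliary form with only `Sub`). [folklore] -/
theorem mem_D_aux {E F : Fin N → Finset H} [Sub H] {i : Fin N} {x : H} :
    x ∈ ((E i) ×ˢ (F i)).image (fun p : H × H => p.2 - p.1) ↔ ∃ e ∈ E i, ∃ f ∈ F i, f - e = x := by
  simp only [Finset.mem_image, Finset.mem_product, Prod.exists]
  constructor
  · rintro ⟨e, f, ⟨he, hf⟩, h⟩; exact ⟨e, he, f, hf, h⟩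
  · rintro ⟨e, he, f, hf, h⟩; exact ⟨e, f, ⟨he, hf⟩, h⟩

/-- Membership in a difference set. [folklore] -/
theorem mem_D {E F : Fin N → Finset H} {i : Fin N} {x : H} : x ∈ D E F i ↔ ∃ e ∈ E i, ∃ f ∈ F i, f - e = x :=
  mem_D_aux

variable {A B C : Fin N → Finset H}

/-- **The defining relation, sumset form.** For an STPP family: `x + y = z` with `x ∈ Xᵢ = Bᵢ − Aᵢ`, `y ∈ Y_k = C_k − B_k`,
`z ∈ Z_j = C_j − A_j` forces `i = j = k` (CKSU Def. 5.1 (ii) with the six witnesses matched to the tree's `IsSTPP`).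
[cite: CohnKleinbergSzegedyUmans2005, Def. 5.1] -/
theorem indices_eq_of_add_eq (hS : IsSTPP A B C) {i j k : Fin N} {x y z : H} (hx : x ∈ D A B i) (hy : y ∈ D B C k)
    (hz : z ∈ D A C j) (h : x + y = z) : i = j ∧ k = j := by
  obtain ⟨a, ha, b, hb, rfl⟩ := mem_D.1 hx
  obtain ⟨b', hb', c, hc, rfl⟩ := mem_D.1 hy
  obtain ⟨a', ha', c', hc', rfl⟩ := mem_D.1 hz
  have hrel : (a - a') + (b' - b) + (c' - c) = 0 := by
    have h' := sub_eq_zero.2 h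
    rw [← neg_eq_zero, ← h']; abel
  obtain ⟨hik, hkj, -, -, -⟩ := hS i k j a' ha' a ha b hb b' hb' c hc c' hc' hrel
  exact ⟨hik.trans hkj, hkj⟩

/-- `|Xᵢ| = |Aᵢ||Bᵢ|`: `(a, b) ↦ b − a` is injective on `Aᵢ × Bᵢ` (TPP of block `i`; needs `Cᵢ ≠ ∅`). [cite: CohnKleinbergSzegedyUmans2005, Def. 5.1] -/
theorem card_D_AB (hS : IsSTPP A B C) (hC : ∀ i, (C i).Nonempty) (i : Fin N) : #(D A B i) = #(A i) * #(B i) := by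
  obtain ⟨u, hu⟩ := hC i
  rw [D, Finset.card_image_of_injOn, Finset.card_product]
  rintro ⟨a, b⟩ hab ⟨a', b'⟩ hab' (h : b - a = b' - a')
  simp only [Finset.coe_product, Set.mem_prod, Finset.mem_coe] at hab hab'
  have hrel : (a' - a) + (b - b') + (u - u) = 0 := by
    have h' := sub_eq_zero.2 h; rw [← h']; abel
  obtain ⟨-, -, h1, h2, -⟩ := hS i i i a hab.1 a' hab'.1 b' hab'.2 b hab.2 u hu u hu hrel
  rw [h1, h2]

/-- `|Yᵢ| = |Bᵢ||Cᵢ|` (needs `Aᵢ ≠ ∅`). [cite: CohnKleinbergSzegedyUmans2005, Def. 5.1] -/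
theorem card_D_BC (hS : IsSTPP A B C) (hA : ∀ i, (A i).Nonempty) (i : Fin N) : #(D B C i) = #(B i) * #(C i) := by
  obtain ⟨s, hs⟩ := hA i
  rw [D, Finset.card_image_of_injOn, Finset.card_product]
  rintro ⟨b, c⟩ hbc ⟨b', c'⟩ hbc' (h : c - b = c' - b')
  simp only [Finset.coe_product, Set.mem_prod, Finset.mem_coe] at hbc hbc'
  have hrel : (s - s) + (b' - b) + (c - c') = 0 := by
    have h' := sub_eq_zero.2 h; rw [← h']; abel
  obtain ⟨-, -, -, h1, h2⟩ := hS i i i s hs s hs b hbc.1 b' hbc'.1 c' hbc'.2 c hbc.2 hrel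
  rw [h1, h2]

/-- `|Zᵢ| = |Aᵢ||Cᵢ|` (needs `Bᵢ ≠ ∅`). [cite: CohnKleinbergSzegedyUmans2005, Def. 5.1] -/
theorem card_D_AC (hS : IsSTPP A B C) (hB : ∀ i, (B i).Nonempty) (i : Fin N) : #(D A C i) = #(A i) * #(C i) := by
  obtain ⟨t, ht⟩ := hB i
  rw [D, Finset.card_image_of_injOn, Finset.card_product]
  rintro ⟨a, c⟩ hac ⟨a', c'⟩ hac' (h : c - a = c' - a')
  simp only [Finset.coe_product, Set.mem_prod, Finset.mem_coe] at hac hac'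
  have hrel : (a' - a) + (t - t) + (c - c') = 0 := by
    have h' := sub_eq_zero.2 h; rw [← h']; abel
  obtain ⟨-, -, h1, -, h2⟩ := hS i i i a hac.1 a' hac'.1 t ht t ht c' hac'.2 c hac.2 hrel
  rw [h1, h2]

/-- The `X`-family is pairwise disjoint. [cite: CohnKleinbergSzegedyUmans2005, Def. 5.1] -/
theorem disjoint_D_AB (hS : IsSTPP A B C) (hC : ∀ i, (C i).Nonempty) {i i' : Fin N} (hii : i ≠ i') :
    Disjoint (D A B i) (D A B i') := by
  rw [Finset.disjoint_left]
  intro x hx hx'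
  obtain ⟨a, ha, b, hb, rfl⟩ := mem_D.1 hx
  obtain ⟨c, hc⟩ := hC i
  have hy : c - b ∈ D B C i := mem_D.2 ⟨b, hb, c, hc, rfl⟩
  have hz : c - a ∈ D A C i := mem_D.2 ⟨a, ha, c, hc, rfl⟩
  have := (indices_eq_of_add_eq hS hx' hy hz (by abel)).1
  exact hii this.symm

/-- The `Y`-family is pairwise disjoint. [cite: CohnKleinbergSzegedyUmans2005, Def. 5.1] -/
theorem disjoint_D_BC (hS : IsSTPP A B C) (hA : ∀ i, (A i).Nonempty) {k k' : Fin N} (hkk : k ≠ k') :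
    Disjoint (D B C k) (D B C k') := by
  rw [Finset.disjoint_left]
  intro y hy hy'
  obtain ⟨b, hb, c, hc, rfl⟩ := mem_D.1 hy
  obtain ⟨a, ha⟩ := hA k
  have hx : b - a ∈ D A B k := mem_D.2 ⟨a, ha, b, hb, rfl⟩
  have hz : c - a ∈ D A C k := mem_D.2 ⟨a, ha, c, hc, rfl⟩
  have := (indices_eq_of_add_eq hS hx hy' hz (by abel)).2
  exact hkk this.symm

/-- The `Z`-family is pairwise disjoint. [cite: CohnKleinbergSzegedyUmans2005, Def. 5.1] -/
theorem disjoint_D_AC (hS : IsSTPP A B C) (hB : ∀ i, (B i).Nonempty) {j j' : Fin N} (hjj : j ≠ j') :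
    Disjoint (D A C j) (D A C j') := by
  rw [Finset.disjoint_left]
  intro z hz hz'
  obtain ⟨a, ha, c, hc, rfl⟩ := mem_D.1 hz
  obtain ⟨b, hb⟩ := hB j
  have hx : b - a ∈ D A B j := mem_D.2 ⟨a, ha, b, hb, rfl⟩
  have hy : c - b ∈ D B C j := mem_D.2 ⟨b, hb, c, hc, rfl⟩
  have := (indices_eq_of_add_eq hS hx hy hz' (by abel)).1
  exact hjj this

/-- `|⋃_{i∈I} Xᵢ| = Σ_{i∈I} |Aᵢ||Bᵢ|`. [cite: CohnKleinbergSzegedyUmans2005, Def. 5.1] -/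
theorem card_DU_AB (hS : IsSTPP A B C) (hC : ∀ i, (C i).Nonempty) (I : Finset (Fin N)) :
    #(DU A B I) = ∑ i ∈ I, #(A i) * #(B i) := by
  rw [DU, Finset.card_biUnion (fun i _ j _ hij => disjoint_D_AB hS hC hij)]
  exact Finset.sum_congr rfl fun i _ => card_D_AB hS hC i

/-- `|⋃_{k∈K} Y_k| = Σ_{k∈K} |B_k||C_k|`. [cite: CohnKleinbergSzegedyUmans2005, Def. 5.1] -/
theorem card_DU_BC (hS : IsSTPP A B C) (hA : ∀ i, (A i).Nonempty) (I : Finset (Fin N)) :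
    #(DU B C I) = ∑ i ∈ I, #(B i) * #(C i) := by
  rw [DU, Finset.card_biUnion (fun i _ j _ hij => disjoint_D_BC hS hA hij)]
  exact Finset.sum_congr rfl fun i _ => card_D_BC hS hA i

/-- `|⋃_{j∈J} Z_j| = Σ_{j∈J} |A_j||C_j|`. [cite: CohnKleinbergSzegedyUmans2005, Def. 5.1] -/
theorem card_DU_AC (hS : IsSTPP A B C) (hB : ∀ i, (B i).Nonempty) (I : Finset (Fin N)) :
    #(DU A C I) = ∑ i ∈ I, #(A i) * #(C i) := by
  rw [DU, Finset.card_biUnion (fun i _ j _ hij => disjoint_D_AC hS hB hij)]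
  exact Finset.sum_congr rfl fun i _ => card_D_AC hS hB i

/-- A difference set of non-empty sets is non-empty. [folklore] -/
theorem D_nonempty {E F : Fin N → Finset H} {i : Fin N} (hE : (E i).Nonempty) (hF : (F i).Nonempty) : (D E F i).Nonempty := by
  obtain ⟨e, he⟩ := hE; obtain ⟨f, hf⟩ := hF
  exact ⟨f - e, mem_D.2 ⟨e, he, f, hf, rfl⟩⟩

/-- A union of non-empty difference sets over a non-empty index set is non-empty. [folklore] -/
theorem DU_nonempty {E F : Fin N → Finset H} {I : Finset (Fin N)} (hI : I.Nonempty) (hE : ∀ i, (E i).Nonempty)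
    (hF : ∀ i, (F i).Nonempty) : (DU E F I).Nonempty := by
  obtain ⟨i, hi⟩ := hI
  obtain ⟨x, hx⟩ := D_nonempty (hE i) (hF i)
  exact ⟨x, Finset.mem_biUnion.2 ⟨i, hi, hx⟩⟩

/-! ## §3 The sumset inclusions (K1a), (K1b), (K2) -/

/-- **(K1a)** `(⋃ᵢ Xᵢ) + (⋃_{k ≠ j} Y_k) ⊆ H ∖ Z_j`. [cite: CohnKleinbergSzegedyUmans2005, Def. 5.1] -/
theorem K1a [Fintype H] (hS : IsSTPP A B C) (j : Fin N) :
    DU A B Finset.univ + DU B C (Finset.univ.erase j) ⊆ Finset.univ \ D A C j := by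
  intro w hw
  rw [Finset.mem_sdiff]
  refine ⟨Finset.mem_univ _, fun hz => ?_⟩
  obtain ⟨x, hx, y, hy, rfl⟩ := Finset.mem_add.1 hw
  obtain ⟨i, -, hx⟩ := Finset.mem_biUnion.1 hx
  obtain ⟨k, hk, hy⟩ := Finset.mem_biUnion.1 hy
  exact (Finset.ne_of_mem_erase hk) (indices_eq_of_add_eq hS hx hy hz rfl).2

/-- **(K1b)** `(⋃_{i ≠ j} Xᵢ) + (⋃_k Y_k) ⊆ H ∖ Z_j`. [cite: CohnKleinbergSzegedyUmans2005, Def. 5.1] -/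
theorem K1b [Fintype H] (hS : IsSTPP A B C) (j : Fin N) :
    DU A B (Finset.univ.erase j) + DU B C Finset.univ ⊆ Finset.univ \ D A C j := by
  intro w hw
  rw [Finset.mem_sdiff]
  refine ⟨Finset.mem_univ _, fun hz => ?_⟩
  obtain ⟨x, hx, y, hy, rfl⟩ := Finset.mem_add.1 hw
  obtain ⟨i, hi, hx⟩ := Finset.mem_biUnion.1 hx
  obtain ⟨k, -, hy⟩ := Finset.mem_biUnion.1 hy
  exact (Finset.ne_of_mem_erase hi) (indices_eq_of_add_eq hS hx hy hz rfl).1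

/-- **(K2)** `X_j + Y_k ⊆ H ∖ ⋃ᵢ Zᵢ` for `j ≠ k`. [cite: CohnKleinbergSzegedyUmans2005, Def. 5.1] -/
theorem K2 [Fintype H] (hS : IsSTPP A B C) {j k : Fin N} (hjk : j ≠ k) :
    D A B j + D B C k ⊆ Finset.univ \ DU A C Finset.univ := by
  intro w hw
  rw [Finset.mem_sdiff]
  refine ⟨Finset.mem_univ _, fun hz => ?_⟩
  obtain ⟨x, hx, y, hy, rfl⟩ := Finset.mem_add.1 hw
  obtain ⟨i, -, hz⟩ := Finset.mem_biUnion.1 hz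
  have h := indices_eq_of_add_eq hS hx hy hz rfl
  exact hjk (h.1.trans h.2.symm)

end Families

/-! ## §4 The decidable numeric predicate and the filter theorem -/

section Filter

/-- One reading of filter N8 on the card vectors `(a, b, c)` of a pattern in a group of order `n`: some pair `j ≠ k` has (K1a) or (K1b)
at `j` or (K2) at `(j, k)` violated for EVERY candidate period `d ∣ n` (bounded quantifier, decidable).  Mirror of
`patterns.kneser_violation` (census engine v0.11) for the identity rotation. [folklore] -/
def N8Dead1 (n N : ℕ) (a b c : Fin N → ℕ) : Bool :=
  decide (∃ j k : Fin N, j ≠ k ∧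
    ((∀ d : ℕ, d < n + 1 → d ∣ n → 0 < d → n - a j * c j < kneserLB (∑ i, a i * b i) (∑ i ∈ Finset.univ.erase j, b i * c i) d) ∨
     (∀ d : ℕ, d < n + 1 → d ∣ n → 0 < d → n - a j * c j < kneserLB (∑ i ∈ Finset.univ.erase j, a i * b i) (∑ i, b i * c i) d) ∨
     (∀ d : ℕ, d < n + 1 → d ∣ n → 0 < d → n - ∑ i, a i * c i < kneserLB (a j * b j) (b k * c k) d)))

/-- **Filter N8** on the card vectors: `N8Dead1` for one of the three rotations `(a,b,c)`, `(b,c,a)`, `(c,a,b)` (the census's three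
readings `x + y = z`, `z − y = x`, `z − x = y`). [folklore] -/
def N8Dead (n N : ℕ) (a b c : Fin N → ℕ) : Bool := N8Dead1 n N a b c || N8Dead1 n N b c a || N8Dead1 n N c a b

variable {H : Type*} [AddCommGroup H] [DecidableEq H] [Fintype H] {N : ℕ} {A B C : Fin N → Finset H}

/-- **Filter N8, one reading (kernel).** An STPP family with non-empty sets whose card vectors satisfy `N8Dead1 |H|` does not exist.
[cite: Kneser1953] [cite: CohnKleinbergSzegedyUmans2005, Def. 5.1] -/
theorem not_isSTPP_of_n8Dead1 (hS : IsSTPP A B C) (hA : ∀ i, (A i).Nonempty) (hB : ∀ i, (B i).Nonempty)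
    (hC : ∀ i, (C i).Nonempty) {n : ℕ} (hn : Fintype.card H = n) {a b c : Fin N → ℕ} (ha : ∀ i, #(A i) = a i)
    (hb : ∀ i, #(B i) = b i) (hc : ∀ i, #(C i) = c i) (hdead : N8Dead1 n N a b c = true) : False := by
  obtain ⟨j, k, hjk, h⟩ := of_decide_eq_true hdead
  have hZj : #(Finset.univ \ D A C j) = n - a j * c j := by
    rw [Finset.card_sdiff_of_subset (Finset.subset_univ _), Finset.card_univ, hn, card_D_AC hS hB j, ha, hc]
  have hne_erase : (Finset.univ.erase j : Finset (Fin N)).Nonempty := ⟨k, Finset.mem_erase.2 ⟨hjk.symm, Finset.mem_univ _⟩⟩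
  -- turn the bounded-divisor hypotheses into the `Nat.divisors` form of `false_of_kneserLB_gt`
  have conv : ∀ {s t u : ℕ}, (∀ d : ℕ, d < n + 1 → d ∣ n → 0 < d → u < kneserLB s t d) →
      ∀ d ∈ Nat.divisors (Fintype.card H), u < kneserLB s t d := by
    intro s t u hall d hd
    rw [hn, Nat.mem_divisors] at hd
    exact hall d (Nat.lt_succ_of_le (Nat.le_of_dvd (Nat.pos_of_ne_zero hd.2) hd.1)) hd.1 (Nat.pos_of_dvd_of_pos hd.1 (Nat.pos_of_ne_zero hd.2))
  rcases h with h | h | h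
  · refine false_of_kneserLB_gt (DU A B Finset.univ) (DU B C (Finset.univ.erase j)) (Finset.univ \ D A C j)
      (DU_nonempty ⟨j, Finset.mem_univ _⟩ hA hB) (DU_nonempty hne_erase hB hC) (K1a hS j) ?_
    rw [hZj, card_DU_AB hS hC, card_DU_BC hS hA]
    simp_rw [ha, hb, hc]
    exact conv h
  · refine false_of_kneserLB_gt (DU A B (Finset.univ.erase j)) (DU B C Finset.univ) (Finset.univ \ D A C j)
      (DU_nonempty hne_erase hA hB) (DU_nonempty ⟨j, Finset.mem_univ _⟩ hB hC) (K1b hS j) ?_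
    rw [hZj, card_DU_AB hS hC, card_DU_BC hS hA]
    simp_rw [ha, hb, hc]
    exact conv h
  · have hU : #(Finset.univ \ DU A C Finset.univ) = n - ∑ i, a i * c i := by
      rw [Finset.card_sdiff_of_subset (Finset.subset_univ _), Finset.card_univ, hn, card_DU_AC hS hB]
      simp_rw [ha, hc]
    refine false_of_kneserLB_gt (D A B j) (D B C k) (Finset.univ \ DU A C Finset.univ)
      (D_nonempty (hA j) (hB j)) (D_nonempty (hB k) (hC k)) (K2 hS hjk) ?_
    rw [hU, card_D_AB hS hC, card_D_BC hS hA, ha, hb, hb, hc]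
    exact conv h

/-- **Filter N8 (kernel): an STPP family with non-empty sets in a finite abelian group `H` whose pattern `(|Aᵢ|,|Bᵢ|,|Cᵢ|)ᵢ` is
`N8Dead |H|` does not exist** — the three readings via the rotations `(A,B,C) ↦ (B,C,A) ↦ (C,A,B)`.  This is the census engine
v0.11 flag `STPP_N8=paper` as a kernel theorem. [cite: Kneser1953] [cite: CohnKleinbergSzegedyUmans2005, Def. 5.1] -/
theorem not_isSTPP_of_n8Dead (hS : IsSTPP A B C) (hA : ∀ i, (A i).Nonempty) (hB : ∀ i, (B i).Nonempty)
    (hC : ∀ i, (C i).Nonempty) {n : ℕ} (hn : Fintype.card H = n) {a b c : Fin N → ℕ} (ha : ∀ i, #(A i) = a i)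
    (hb : ∀ i, #(B i) = b i) (hc : ∀ i, #(C i) = c i) (hdead : N8Dead n N a b c = true) : False := by
  simp only [N8Dead, Bool.or_eq_true] at hdead
  rcases hdead with (h | h) | h
  · exact not_isSTPP_of_n8Dead1 hS hA hB hC hn ha hb hc h
  · exact not_isSTPP_of_n8Dead1 (stpp_rotate hS) hB hC hA hn hb hc ha h
  · exact not_isSTPP_of_n8Dead1 (stpp_rotate (stpp_rotate hS)) hC hA hB hn hc ha hb h

/-- Card-vector form with literal vectors: non-emptiness comes from positivity of the entries. [cite: Kneser1953] -/
theorem not_isSTPP_of_n8Dead' (hS : IsSTPP A B C) {n : ℕ} (hn : Fintype.card H = n) (a b c : Fin N → ℕ)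
    (ha : ∀ i, #(A i) = a i) (hb : ∀ i, #(B i) = b i) (hc : ∀ i, #(C i) = c i)
    (hpos : ∀ i, 0 < a i ∧ 0 < b i ∧ 0 < c i) (hdead : N8Dead n N a b c = true) : False :=
  not_isSTPP_of_n8Dead hS (fun i => Finset.card_pos.1 ((ha i).symm ▸ (hpos i).1))
    (fun i => Finset.card_pos.1 ((hb i).symm ▸ (hpos i).2.1)) (fun i => Finset.card_pos.1 ((hc i).symm ▸ (hpos i).2.2))
    hn ha hb hc hdead

end Filter

/-! ## §5 Example: a ℤ₅₆ frontier leaf decided by Kneser instead of a search -/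

section Examples

variable {H : Type*} [AddCommGroup H] [DecidableEq H] [Fintype H]

/-- The ℤ₅₆ frontier leaf `{(1,3,11), (2,3,4)}` (`∑ abc = 57 > 56`; DFS engines: minutes) carries no STPP family in ANY abelian group of
order `56`: (K1b) at `j = 0` reads "a `6`-set plus a `45`-set inside a `45`-set", impossible by Kneser for every period `d ∣ 56`.
[cite: Kneser1953] [cite: CohnKleinbergSzegedyUmans2005, Def. 5.1] -/
theorem no_isSTPP_Z56_13b_234 (hH : Fintype.card H = 56) (A B C : Fin 2 → Finset H) (hS : IsSTPP A B C)
    (hA : ∀ i, #(A i) = ![1, 2] i) (hB : ∀ i, #(B i) = ![3, 3] i) (hC : ∀ i, #(C i) = ![11, 4] i) : False :=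
  not_isSTPP_of_n8Dead' hS hH _ _ _ hA hB hC (by decide) (by decide)

end Examples

end Summit.MatrixMultiplication.OmegaCensus.STPPKneser
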